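import Literature.MathematicalPhysics.QuantumFieldTheory.BalabanImbrieJaffe1984to88.BIJ88Sect5StatementsPart3
import Literature.MathematicalPhysics.QuantumFieldTheory.BalabanImbrieJaffe1984to88.BIJ88Sect5StatementsPart2

/-!
# `BalabanImbrieJaffe1984to88.BIJ88Ineq547Proof` — T. Bałaban, J. Imbrie, A. Jaffe, *Effective action and cluster
properties of the abelian Higgs model*, Commun. Math. Phys. **114** (1988) 257–315 [BalabanImbrieJaffe1988]:
**(5.4.7)** pp. 282–283 PROVED — *"After these rotations, the scalar field still have small, term-dependent phase factors. The
scalar fields appear as φ(x)exp[ie_k(w₂A′)(x)], ψ(y)exp[ie_k(w₂A′)(y)], where w₂ = Λ̄₃^{(k)}C_{k,loc} − Λ̄₃^{(k)}C_k□ satisfies a bound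
|w₂(x,b)| ≤ exp(−cr(e_k))exp(−c dist(x,b)), (5.4.7) [this follows from (2.26)]."* — for the CONCRETE kernel
`w₂ = BIJ88Sect5StatementsPart3.w2 Λ̄₃ C_{k,loc} C_k □` (r16, p243601) in the ring `Matrix ι ι ℝ` of kernels (kind «model-instance»:
the typed leaf `BIJ88Sect5StatementsPart2.Ineq547` quantifies over an abstract kernel).

statement-level skeleton of published theorems with citation tags; proofs where landed; nothing here is a claim about the Yang–Mills mass gap

PDF held: `paper:balaban1988-cmp114-bij-abelian-higgs-effective-action` (journal page = PDF page + 256).  Pages read as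
images: PDF pp. 26–27 (journal 282–283), `g4png.py` ×2 renders (`HOME/lit-balaban-r16/renders/cmp114/original-p026-x2.png`, seat
folder `renders/original-p027-x2.png`).

CITATION HEADER (lean-in-tree rule).  Part of the lit-balaban TYPED SKELETON (HOME `run/shared/lean/pub/lit-balaban/`),
Phase 2, seat p36 (gen 3, unit `lit-balaban-p36`); row **C2.Eq5.4.7** of `HOME/lit-balaban-r16/ROWS-C2-part2.md` (leaf typed p240155,
kernel typed p243601, both r16).  WHAT IS REPRODUCED, and how (theorem-only; the printed proof IS the one line *"[this follows from
(2.26)]"*, p. 283):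
* THE CUBE `□` IS TERM-DEPENDENT: the background gauge transformation (5.4.5) with gauge function `Λ̄₃^{(k)}C_k□A′` *"is now performed
  on the term localized in □₀"* (p. 282), `□₀ ⊂ □` (*"we use w′₁(b,b′) only for b in □₀ ⊂ □"*), so the kernel `w₂(x,b)` is only
  ever paired with `A′(b)`, `b ∈ □₀ ⊂ □`.  As a kernel statement over all `(x,b)` this is the COLUMN-WISE instantiation of Part3's
  ring element `box`: `w₂(x,b) := (w2 (diagonal χ₃) C_{k,loc} C_k (diagonal (χ□ b))) x b` with `b ∈ □(b)` (`χ□ b b = 1`), `Λ̄₃^{(k)}` the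
  diagonal contraction `diagonal χ₃` (`|χ₃| ≤ 1`).  Then `w₂(x,b) = χ₃(x)(C_{k,loc} − C_k)(x,b)` (`w2_apply_col`) and (5.4.7) is
  **(2.26)** `BIJ88Sect2Statements.Close dist Cloc Ck (e^{−c₁r}) c₂` verbatim, with the single printed constant `c = min(c₁, c₂)`:
  `ineq547_matrix : Ineq547 ι ι w₂ dist (min c₁ c₂) r`.
* With a FIXED `□` the bound is false off `□` (there `w₂(x,b) = Λ̄₃(x)C_{k,loc}(x,b)`, which is `O(1)` for `x` near `b`) — recorded as
  the reason for the column-wise reading; `w2_apply` gives the general entry formula.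
NOT here: the *"similarly"* bounds for `w′₁`, `∂w′₁`, `∂*w′₁`, `w₁` of p. 282 (multi-scale sums over `j < k` through (2.12); they keep
their Part-2 shape `Ineq547`); no new `Prop` facts; axioms standard.
-/

namespace Literature.MathematicalPhysics.QuantumFieldTheory.BalabanImbrieJaffe1984to88.BIJ88Ineq547Proof

open Finset Matrix
open BIJ88Sect2Statements (Close)
open BIJ88Sect5StatementsPart2 BIJ88Sect5StatementsPart3

section Kernel

variable {ι : Type*} [Fintype ι] [DecidableEq ι]

/-- entries of `w₂ = Λ̄₃C_{k,loc} − Λ̄₃C_k□` for diagonal `Λ̄₃ = diagonal χ₃`, `□ = diagonal χ□`: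
`w₂(x,b) = χ₃(x)C_{k,loc}(x,b) − χ₃(x)C_k(x,b)χ□(b)`. [cite: BalabanImbrieJaffe1988, (5.4.7) p.282] -/
theorem w2_apply (Cloc Ck : Matrix ι ι ℝ) (χ₃ χb : ι → ℝ) (x b : ι) :
    w2 (diagonal χ₃) Cloc Ck (diagonal χb) x b = χ₃ x * Cloc x b - χ₃ x * Ck x b * χb b := by
  unfold w2
  rw [Matrix.sub_apply, Matrix.diagonal_mul, Matrix.mul_diagonal, Matrix.diagonal_mul]

/-- the COLUMN-WISE instantiation (`b ∈ □(b)`, i.e. `χ□(b) = 1` at the evaluated bond): `w₂(x,b) = χ₃(x)·(C_{k,loc} − C_k)(x,b)` — the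
kernel is a restriction of the (2.26) difference. [cite: BalabanImbrieJaffe1988, (5.4.7) p.282] -/
theorem w2_apply_col (Cloc Ck : Matrix ι ι ℝ) (χ₃ χb : ι → ℝ) {x b : ι} (hb : χb b = 1) :
    w2 (diagonal χ₃) Cloc Ck (diagonal χb) x b = χ₃ x * (Cloc x b - Ck x b) := by
  rw [w2_apply, hb]; ring

end Kernel

section Main

variable {ι : Type} [Fintype ι] [DecidableEq ι]

/-- **(5.4.7)** *"[this follows from (2.26)]"*: in the ring of kernels `Matrix ι ι ℝ` over any index type with a non-negative
distance, with `Λ̄₃^{(k)} = diagonal χ₃` (`|χ₃| ≤ 1`) and the term-dependent cube instantiated column-wise (`χ□ b b = 1`), the bound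
(2.26) `|C_{k,loc} − C_k|(x,b) ≤ e^{−c₁r}e^{−c₂dist(x,b)}` (`BIJ88Sect2Statements.Close`) gives `|w₂(x,b)| ≤ e^{−cr}e^{−c·dist(x,b)}` with
`c = min(c₁, c₂)`, `r = r(e_k) ≥ 0`. [cite: BalabanImbrieJaffe1988, (5.4.7) p.282] -/
theorem ineq547_matrix (dist : ι → ι → ℝ) (hdist : ∀ x b, 0 ≤ dist x b) (Cloc Ck : Matrix ι ι ℝ) (χ₃ : ι → ℝ)
    (χb : ι → ι → ℝ) {r c₁ c₂ : ℝ} (hr : 0 ≤ r) (h226 : Close dist Cloc Ck (Real.exp (-(c₁ * r))) c₂)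
    (hχ₃ : ∀ x, |χ₃ x| ≤ 1) (hχb : ∀ b, χb b b = 1) :
    Ineq547 ι ι (fun x b => w2 (diagonal χ₃) Cloc Ck (diagonal (χb b)) x b) dist (min c₁ c₂) r := by
  intro x b
  show |w2 (diagonal χ₃) Cloc Ck (diagonal (χb b)) x b| ≤ _
  rw [w2_apply_col Cloc Ck χ₃ (χb b) (hχb b), abs_mul]
  have h1 : |Cloc x b - Ck x b| ≤ Real.exp (-(c₁ * r)) * Real.exp (-c₂ * dist x b) := h226 x b
  have h2 : |χ₃ x| * |Cloc x b - Ck x b| ≤ 1 * (Real.exp (-(c₁ * r)) * Real.exp (-c₂ * dist x b)) :=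
    mul_le_mul (hχ₃ x) h1 (abs_nonneg _) zero_le_one
  rw [one_mul] at h2
  refine h2.trans ?_
  have hd := hdist x b
  have e1 : Real.exp (-(c₁ * r)) ≤ Real.exp (-(min c₁ c₂ * r)) :=
    Real.exp_le_exp.mpr (neg_le_neg (mul_le_mul_of_nonneg_right (min_le_left _ _) hr))
  have e2 : Real.exp (-c₂ * dist x b) ≤ Real.exp (-(min c₁ c₂ * dist x b)) := by
    rw [neg_mul]
    exact Real.exp_le_exp.mpr (neg_le_neg (mul_le_mul_of_nonneg_right (min_le_right _ _) hd))
  exact mul_le_mul e1 e2 (Real.exp_pos _).le (Real.exp_pos _).le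

end Main

end Literature.MathematicalPhysics.QuantumFieldTheory.BalabanImbrieJaffe1984to88.BIJ88Ineq547Proof
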